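import Literature.MathematicalPhysics.QuantumFieldTheory.Balaban1983to89.Beta.WilsonVertex2Sym
import Summits.QuantumFields.BalabanUV.Beta.GAN24.WilsonQuarticCharge
import Summits.QuantumFields.BalabanUV.Beta.GAN24.FourFaceOneCovPlaquette
import Summits.QuantumFields.BalabanUV.Beta.GAN24.T2RecChargeStep

/-!
# `BalabanUV.Beta.GAN24.WilsonBiStencilCornerSupport` — binder row G-an2-4 ∕ (CONV-C), W-slot CT-route, (C)_0 ∕ (C)sym level-0 kernel programme (blueprint (L5) ∕
# (III) CONTACT, leaf-02's register; sibling of `GAN24/FourFaceOneCovPlaquette`): **an3's WILSON BI-STENCIL `wilsonW₂ d T` IS CORNER-SUPPORTED for every position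
# table `T` whose DEGENERATE-CELL BOX SUMS vanish — in particular for the D1 literal's `wsym22 N` — hence `N⁴ · fourFace_N (wilsonW₂ d T) = N^{4 − #S} · zmode` on
# EVERY direction pattern** («plaquette-local table ⇒ contact ratio `L²`», R-leaf04-g64-1 (3)(b), as a theorem)

NOT IN PRINT; OUR BOOKKEEPING (G-an2-4 crux team (2), leaf prover `b2b-balaban-gan24-formalise-leaf-02`, gen 62; INTENT I-leaf02-g62-1 §4).  HONEST FRAMING (cell
contract, verbatim): «discharging `BetaPertH` makes Bałaban's UV stability UNCONDITIONAL — a real constructive-QFT result; it is NOT the continuum limit and NOT the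
Clay problem.»  HONEST DEPENDENCY (verbatim): «continuum YM on T⁴ ⇐ BetaPertH ∧ nine spine estimates (0/9 proved); BetaPertH ⇐ (D1) ∧ (D4) ∧ CAP+tail; G-an2-4
gates asym, D1 and NE2/3/4.»  [folklore] finite plaquette geometry + table algebra over an3's DEFINED objects (`WilsonBiStencil.wilsonW₂` ∕ `WilsonVertex2Kron.bondPairTab`,
`PlaquetteVertex2Stencil.dir ∕ off`, `WilsonVertex2Sym.wsym22`) BY NAME; generic `d`; 0 `def`, 0 cited facts, 0 `def … : Prop`, 0 sorry.  Discharges NOTHING of (C) ∕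
(C)sym ∕ (Q-L) ∕ «T2Shape» ∕ «T2Drift» ∕ (hW, hWall); NEVER «G-an2-4 closed» as (CONV-C); NOT D1, NOT BetaPertH, NOT continuum, NOT Clay.

## What
THE GEOMETRY.  A bond `(dir s, c + off s)` of the plaquette `p_{μν}(c)`, `μ ≠ ν`, satisfies `(off s)_{dir s} = 0` (`off_apply_dir`): every bond agrees with the corner
in its own direction.  `bondPairTab` (hence `wilsonW₂`) sums over ALL direction pairs `(μ, ν)` INCLUDING the DEGENERATE cells `μ = ν`, whose four positions collapse
pairwise (`0 ≡ 3`, `1 ≡ 2`, i.e. `s ≡ s.rev`: `off_self_rev`, `dir_self`); a degenerate cell contributes to an entry the BOX SUM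
`Σ_{k′∈{k,k.rev}} Σ_{l′∈{l,l.rev}} Σ_{i′∈{i,i.rev}} Σ_{j′∈{j,j.rev}} T i′ j′ k′ l′` of its table — these vanish for the physical tables (`wsym22`: sign structure
`s_{s.rev} = −s_s` + the alternating box identity of the interleaving table `chi`, a finite check), NOT for a generic `T`.
* §1 `off_apply_dir`, `dir_self`, `off_self_rev`, `ne_rev` (plaquette geometry on `Fin 4`).
* §2 `sum_fin4_of_rev_inv`, **`sum4_mul_eq_zero_of_boxSums`** — a slot-wise `rev`-invariant weight against a table with vanishing box sums sums to zero.
* §3 `degenerateCell_sum_eq_zero`, **`wilsonW₂_cornerSupport`**: box sums of `T` vanish ⇒ (`wilsonW₂ d T κ 0 κ′ u′ x z (inl α) (inl β) ≠ 0 → ∃ c, c κ = 0 ∧ c κ′ = u′ κ′ ∧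
  c α = x α ∧ c β = z β`) — the corner-support hypothesis of `FourFaceOneCovPlaquette.fourFace_mul_eq_pow_mul_zmode_of_cornerSupport`.
* §4 `boxSums_smul`, `sgnZ_chiZ_boxSum` ∕ `sgnZ_boxSum` (`decide` over `ℤ`), **`boxSums_wsym22`**: `wsym22 N` (and `c • wsym22 N`, so the D1 literal's
  `Tc = (8N²)⁻¹ • wsym22 N`) has vanishing box sums.
* §5 **`fourFace_wilsonW₂_mul_eq_pow_mul_zmode`**: for such `T`, every `1 ≤ N` and EVERY pattern `(κ,κ′;α,β)`:
  `N⁴ · fourFace_N (wilsonW₂ d T)(κ,κ′;α,β) = N^{4 − #{κ,κ′,α,β}} · zmode N (wilsonW₂ d T) κ κ′ (inl α) (inl β)`; **`fourFace_wilsonW₂_wsym22`** (the literal's table).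
* §6 THE INSTANCE THE (C)_0 ASSEMBLY READS (blueprint (L4b) ∕ (III), p2's currency `T2RecChargeStepFourFace.zmode_succ_eq_fourFace` at `j = 0`): `zmode_memberZero_eq`,
  **`fourFace_memberZero_mul_eq_pow_mul_zmode`** — for the normalised comb member `T̃_0 = unitS₂ (sfStep Lc 0) (smStep d Lc 0) (T2RecAt d Lc ρ cE cVH cΛ cE₂ cB Tc vh₂S mixFF 0)`
  (any root `ρ`, any pins, any mixed table, a border `vh₂S` with no ff block (`hBff`), `Tc` with vanishing box sums), every `1 ≤ N`, every pattern:
  `N⁴ · fourFace_N (T̃_0)(μ,ν;α,β) = N^{4 − #{μ,ν,α,β}} · zmode N T̃_0 μ ν (inl α) (inl β)` (p2's `member_zero_inl_inl`: the ff entries of `T̃_0` are `cE₂ ·` an3's);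
  **`fourFace_memberZero_wsym22`** — the same at the literal's `Tc = c • wsym22 M`, NO table hypothesis left.
-/

noncomputable section

open Finset
open scoped BigOperators
open Literature.MathematicalPhysics.QuantumFieldTheory
open Literature.MathematicalPhysics.QuantumFieldTheory.Balaban1983to89
open Literature.MathematicalPhysics.QuantumFieldTheory.Balaban1983to89.Beta
open B6BondElimination (unitVec)
open ExpKernelCalculus (MKer shiftK)
open AffineAveraging (Site box toSite)
open OneStepResolventKernel (Fib)
open BalabanCompositeJets (LocStencil₂)
open PlaquetteVertex2Stencil (dir off)
open PlaquetteVertex2Coords (sgn)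
open WilsonVertex2Sym (wsym22 chi chiZ sgnZ sgn_eq_cast chi_eq_cast)
open WilsonBiStencil (wilsonW₂ wEntry₂ wBound₂ wilsonW₂_inl_inl biLoc_wilsonW₂_all wilsonW₂_translate)
open Summit.QuantumFields.BalabanUV.Beta.GAN24.BiStencilZeroMode (Tab zmode)
open Summit.QuantumFields.BalabanUV.Beta.GAN24.WilsonQuarticCharge (wilsonW₂_ff_apply)
open Summit.QuantumFields.BalabanUV.Beta.GAN24.FourFaceOneCovPlaquette (fourFace_mul_eq_pow_mul_zmode_of_cornerSupport)
open Summit.QuantumFields.BalabanUV.Beta.SecondOrderUnits (unitS₂)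
open Summit.QuantumFields.BalabanUV.Beta.SpineRooted (T2RecAt)
open Summit.QuantumFields.BalabanUV.Beta.GAN24.CombesThomas (sfStep smStep)
open Summit.QuantumFields.BalabanUV.Beta.GAN24.T2RecChargeStep (member_zero_inl_inl)

namespace Summit.QuantumFields.BalabanUV.Beta.GAN24.WilsonBiStencilCornerSupport

variable {d : ℕ}

/-! ## §1 Plaquette geometry on `Fin 4` -/

/-- [folklore] **EVERY BOND OF A NON-DEGENERATE PLAQUETTE AGREES WITH THE CORNER IN ITS OWN DIRECTION**: `(off s)_{dir s} = 0` for `μ ≠ ν`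
(positions `(c, μ), (c + e_μ, ν), (c + e_ν, μ), (c, ν)`). -/
theorem off_apply_dir {μ ν : Fin (d + 1)} (hμν : μ ≠ ν) (s : Fin 4) : off unitVec μ ν s (dir μ ν s) = 0 := by
  fin_cases s
  · rfl
  · show unitVec μ ν = 0
    simp only [unitVec, if_neg (Ne.symm hμν)]
  · show unitVec ν μ = 0
    simp only [unitVec, if_neg hμν]
  · rfl

/-- [folklore] In a degenerate cell all four positions point in the one direction. -/
theorem dir_self (μ : Fin (d + 1)) (s : Fin 4) : dir μ μ s = μ := by
  fin_cases s <;> rfl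

/-- [folklore] In a degenerate cell the positions `s` and `s.rev` coincide (`0 ≡ 3` at the corner, `1 ≡ 2` at `c + e_μ`). -/
theorem off_self_rev (e : Fin (d + 1) → Site (d + 1)) (μ : Fin (d + 1)) (s : Fin 4) : off e μ μ s.rev = off e μ μ s := by
  fin_cases s <;> rfl

/-- [folklore] `rev` has no fixed point on `Fin 4`. -/
theorem ne_rev (s : Fin 4) : s ≠ s.rev := by
  fin_cases s <;> decide

/-! ## §2 A slot-wise `rev`-invariant weight against a table with vanishing box sums -/

/-- [folklore] ONE SLOT: a `rev`-invariant weight pairs the summand at `s` with the one at `s.rev`: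
`Σ_s w s · g s = Σ_{s ∈ {0,1}} w s · (g s + g s.rev)`. -/
theorem sum_fin4_of_rev_inv {w : Fin 4 → ℝ} (hw : ∀ s, w s.rev = w s) (g : Fin 4 → ℝ) :
    ∑ s, w s * g s = ∑ s ∈ ({0, 1} : Finset (Fin 4)), w s * ∑ s' ∈ ({s, s.rev} : Finset (Fin 4)), g s' := by
  rw [Finset.sum_pair (show (0 : Fin 4) ≠ 1 by decide), Finset.sum_pair (ne_rev 0), Finset.sum_pair (ne_rev 1), Fin.sum_univ_four]
  have h3 : w 3 = w 0 := hw 0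
  have h2 : w 2 = w 1 := hw 1
  have e0 : (0 : Fin 4).rev = 3 := rfl
  have e1 : (1 : Fin 4).rev = 2 := rfl
  rw [e0, e1, h3, h2]
  ring

/-- NOT IN PRINT; OUR BOOKKEEPING.  **A WEIGHT THAT IS `rev`-INVARIANT IN EACH OF ITS FOUR SLOTS, summed against a table `T` all of whose BOX SUMS
`Σ_{k′∈{k,k.rev}} Σ_{l′∈{l,l.rev}} Σ_{i′∈{i,i.rev}} Σ_{j′∈{j,j.rev}} T i′ j′ k′ l′` vanish, GIVES ZERO** — the degenerate cells of `bondPairTab` see their table only through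
these box sums. -/
theorem sum4_mul_eq_zero_of_boxSums {W : Fin 4 → Fin 4 → Fin 4 → Fin 4 → ℝ} {T : Fin 4 → Fin 4 → Fin 4 → Fin 4 → ℝ}
    (hWk : ∀ k l i j, W k.rev l i j = W k l i j) (hWl : ∀ k l i j, W k l.rev i j = W k l i j) (hWi : ∀ k l i j, W k l i.rev j = W k l i j)
    (hWj : ∀ k l i j, W k l i j.rev = W k l i j)
    (hT : ∀ i j k l : Fin 4, ∑ k' ∈ ({k, k.rev} : Finset (Fin 4)), ∑ l' ∈ ({l, l.rev} : Finset (Fin 4)), ∑ i' ∈ ({i, i.rev} : Finset (Fin 4)),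
      ∑ j' ∈ ({j, j.rev} : Finset (Fin 4)), T i' j' k' l' = 0) :
    ∑ k, ∑ l, ∑ i, ∑ j, W k l i j * T i j k l = 0 := by
  -- innermost slot `j`
  have sj : ∀ k l i, ∑ j, W k l i j * T i j k l = ∑ j ∈ ({0, 1} : Finset (Fin 4)), W k l i j * ∑ j' ∈ ({j, j.rev} : Finset (Fin 4)), T i j' k l :=
    fun k l i => sum_fin4_of_rev_inv (fun s => hWj k l i s) _
  simp_rw [sj]
  -- slot `i`
  have si : ∀ k l, (∑ i, ∑ j ∈ ({0, 1} : Finset (Fin 4)), W k l i j * ∑ j' ∈ ({j, j.rev} : Finset (Fin 4)), T i j' k l)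
      = ∑ j ∈ ({0, 1} : Finset (Fin 4)), ∑ i ∈ ({0, 1} : Finset (Fin 4)), W k l i j *
          ∑ i' ∈ ({i, i.rev} : Finset (Fin 4)), ∑ j' ∈ ({j, j.rev} : Finset (Fin 4)), T i' j' k l := by
    intro k l
    rw [Finset.sum_comm]
    exact Finset.sum_congr rfl fun j _ => sum_fin4_of_rev_inv (fun s => hWi k l s j) _
  simp_rw [si]
  -- slot `l`
  have sl : ∀ k, (∑ l, ∑ j ∈ ({0, 1} : Finset (Fin 4)), ∑ i ∈ ({0, 1} : Finset (Fin 4)), W k l i j *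
        ∑ i' ∈ ({i, i.rev} : Finset (Fin 4)), ∑ j' ∈ ({j, j.rev} : Finset (Fin 4)), T i' j' k l)
      = ∑ j ∈ ({0, 1} : Finset (Fin 4)), ∑ i ∈ ({0, 1} : Finset (Fin 4)), ∑ l ∈ ({0, 1} : Finset (Fin 4)), W k l i j *
          ∑ l' ∈ ({l, l.rev} : Finset (Fin 4)), ∑ i' ∈ ({i, i.rev} : Finset (Fin 4)), ∑ j' ∈ ({j, j.rev} : Finset (Fin 4)), T i' j' k l' := by
    intro k
    rw [Finset.sum_comm]
    refine Finset.sum_congr rfl fun j _ => ?_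
    rw [Finset.sum_comm]
    exact Finset.sum_congr rfl fun i _ => sum_fin4_of_rev_inv (fun s => hWl k s i j) _
  simp_rw [sl]
  -- slot `k`
  rw [Finset.sum_comm]
  refine Finset.sum_eq_zero fun j _ => ?_
  rw [Finset.sum_comm]
  refine Finset.sum_eq_zero fun i _ => ?_
  rw [Finset.sum_comm]
  refine Finset.sum_eq_zero fun l _ => ?_
  rw [sum_fin4_of_rev_inv (fun s => hWk s l i j)]
  refine Finset.sum_eq_zero fun k _ => ?_
  rw [hT i j k l, mul_zero]

/-! ## §3 The degenerate cells cancel; the non-degenerate cells hang off their corner -/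

/-- [folklore] A triple guard as a weight. -/
theorem ite_ite_ite_eq_boole_mul (P Q R : Prop) [Decidable P] [Decidable Q] [Decidable R] (t : ℝ) :
    (if P then (if Q then (if R then t else 0) else 0) else 0) = (if (P ∧ Q ∧ R) then (1 : ℝ) else 0) * t := by
  by_cases hP : P <;> by_cases hQ : Q <;> by_cases hR : R <;> simp [hP, hQ, hR]

/-- NOT IN PRINT; OUR BOOKKEEPING.  **A DEGENERATE CELL `μ = ν` OF `bondPairTab` CONTRIBUTES NOTHING TO ANY ENTRY** when the box sums of `T` vanish: its
guards depend on the positions `k l i j` only through `off μ μ ·` and `dir μ μ ·`, both `rev`-invariant (§1), so §2 applies.  (The unfolded entry shape is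
`WilsonQuarticCharge.wilsonW₂_ff_apply`'s, at any first bond `u`.) -/
theorem degenerateCell_sum_eq_zero (T : Fin 4 → Fin 4 → Fin 4 → Fin 4 → ℝ)
    (hT : ∀ i j k l : Fin 4, ∑ k' ∈ ({k, k.rev} : Finset (Fin 4)), ∑ l' ∈ ({l, l.rev} : Finset (Fin 4)), ∑ i' ∈ ({i, i.rev} : Finset (Fin 4)),
      ∑ j' ∈ ({j, j.rev} : Finset (Fin 4)), T i' j' k' l' = 0)
    (μ κ κ' : Fin (d + 1)) (u u' x z : Site (d + 1)) (α β : Fin (d + 1)) :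
    (∑ k : Fin 4, ∑ l : Fin 4,
        if dir μ μ k = κ ∧ dir μ μ l = κ' ∧ u - off unitVec μ μ k + off unitVec μ μ l = u' then
          ∑ i : Fin 4, ∑ j : Fin 4,
            if x = u - off unitVec μ μ k + off unitVec μ μ i ∧ z = u - off unitVec μ μ k + off unitVec μ μ j then
              (if α = dir μ μ i ∧ β = dir μ μ j then T i j k l else 0) else 0
        else 0) = 0 := by
  -- push the outer guard inside and turn the guards into a weight
  have e : ∀ k l : Fin 4,
      (if dir μ μ k = κ ∧ dir μ μ l = κ' ∧ u - off unitVec μ μ k + off unitVec μ μ l = u' then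
          ∑ i : Fin 4, ∑ j : Fin 4,
            if x = u - off unitVec μ μ k + off unitVec μ μ i ∧ z = u - off unitVec μ μ k + off unitVec μ μ j then
              (if α = dir μ μ i ∧ β = dir μ μ j then T i j k l else 0) else 0
        else 0)
      = ∑ i : Fin 4, ∑ j : Fin 4,
          (if ((dir μ μ k = κ ∧ dir μ μ l = κ' ∧ u - off unitVec μ μ k + off unitVec μ μ l = u') ∧
              (x = u - off unitVec μ μ k + off unitVec μ μ i ∧ z = u - off unitVec μ μ k + off unitVec μ μ j) ∧ (α = dir μ μ i ∧ β = dir μ μ j))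
            then (1 : ℝ) else 0) * T i j k l := by
    intro k l
    by_cases hC : dir μ μ k = κ ∧ dir μ μ l = κ' ∧ u - off unitVec μ μ k + off unitVec μ μ l = u'
    · rw [if_pos hC]
      refine Finset.sum_congr rfl fun i _ => Finset.sum_congr rfl fun j _ => ?_
      rw [← ite_ite_ite_eq_boole_mul, if_pos hC]
    · rw [if_neg hC]
      symm
      refine Finset.sum_eq_zero fun i _ => Finset.sum_eq_zero fun j _ => ?_
      rw [if_neg (fun h => hC h.1), zero_mul]
  simp_rw [e]
  refine sum4_mul_eq_zero_of_boxSums ?_ ?_ ?_ ?_ hT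
  · intro k l i j; simp only [off_self_rev, dir_self]
  · intro k l i j; simp only [off_self_rev, dir_self]
  · intro k l i j; simp only [off_self_rev, dir_self]
  · intro k l i j; simp only [off_self_rev, dir_self]

/-- NOT IN PRINT; OUR BOOKKEEPING.  **an3's WILSON BI-STENCIL IS CORNER-SUPPORTED** for every position table `T` whose box sums vanish: a non-zero field–field entry
at first bond `(κ, 0)`, second bond `(κ′, u′)`, legs `(α, x)`, `(β, z)` forces a site `c` (the corner `−off k` of a contributing NON-degenerate cell) with
`c κ = 0`, `c κ′ = u′ κ′`, `c α = x α`, `c β = z β` — the hypothesis of `FourFaceOneCovPlaquette.fourFace_mul_eq_pow_mul_zmode_of_cornerSupport` at `a′ b′ = inl α, inl β`. -/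
theorem wilsonW₂_cornerSupport (T : Fin 4 → Fin 4 → Fin 4 → Fin 4 → ℝ)
    (hT : ∀ i j k l : Fin 4, ∑ k' ∈ ({k, k.rev} : Finset (Fin 4)), ∑ l' ∈ ({l, l.rev} : Finset (Fin 4)), ∑ i' ∈ ({i, i.rev} : Finset (Fin 4)),
      ∑ j' ∈ ({j, j.rev} : Finset (Fin 4)), T i' j' k' l' = 0)
    (κ κ' : Fin (d + 1)) (u' x z : Site (d + 1)) (α β : Fin (d + 1)) (h : wilsonW₂ d T κ 0 κ' u' x z (Sum.inl α) (Sum.inl β) ≠ 0) :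
    ∃ c : Site (d + 1), c κ = 0 ∧ c κ' = u' κ' ∧ c α = x α ∧ c β = z β := by
  by_contra hc
  apply h
  rw [wilsonW₂_ff_apply]
  refine Finset.sum_eq_zero fun μ _ => Finset.sum_eq_zero fun ν _ => ?_
  by_cases hμν : μ = ν
  · subst hμν
    exact degenerateCell_sum_eq_zero T hT μ κ κ' 0 u' x z α β
  · refine Finset.sum_eq_zero fun k _ => Finset.sum_eq_zero fun l _ => ?_
    split_ifs with hC
    · refine Finset.sum_eq_zero fun i _ => Finset.sum_eq_zero fun j _ => ?_
      split_ifs with hD hE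
      · exfalso
        obtain ⟨hk, hl, hu'⟩ := hC
        obtain ⟨hx, hz⟩ := hD
        obtain ⟨hα, hβ⟩ := hE
        refine hc ⟨0 - off unitVec μ ν k, ?_, ?_, ?_, ?_⟩
        · rw [← hk, Pi.sub_apply, Pi.zero_apply, off_apply_dir hμν k, sub_zero]
        · rw [← hu', ← hl, Pi.add_apply, off_apply_dir hμν l, add_zero]
        · rw [hx, hα, Pi.add_apply, off_apply_dir hμν i, add_zero]
        · rw [hz, hβ, Pi.add_apply, off_apply_dir hμν j, add_zero]
      · rfl
      · rfl
    · rfl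

/-! ## §4 Tables with vanishing box sums: scalar multiples, `wsym22 N` -/

/-- [folklore] Box sums of a scalar multiple. -/
theorem boxSums_smul {T : Fin 4 → Fin 4 → Fin 4 → Fin 4 → ℝ}
    (hT : ∀ i j k l : Fin 4, ∑ k' ∈ ({k, k.rev} : Finset (Fin 4)), ∑ l' ∈ ({l, l.rev} : Finset (Fin 4)), ∑ i' ∈ ({i, i.rev} : Finset (Fin 4)),
      ∑ j' ∈ ({j, j.rev} : Finset (Fin 4)), T i' j' k' l' = 0) (c : ℝ) (i j k l : Fin 4) :
    ∑ k' ∈ ({k, k.rev} : Finset (Fin 4)), ∑ l' ∈ ({l, l.rev} : Finset (Fin 4)), ∑ i' ∈ ({i, i.rev} : Finset (Fin 4)),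
      ∑ j' ∈ ({j, j.rev} : Finset (Fin 4)), (c • T) i' j' k' l' = 0 := by
  simp only [Pi.smul_apply, smul_eq_mul, ← Finset.mul_sum, hT, mul_zero]

/-- [folklore] **THE ALTERNATING BOX IDENTITY OF THE INTERLEAVING TABLE** (decided over `ℤ`): for every `i j k l`,
`Σ_{ε ∈ {0,1}⁴} (−1)^{|ε|} chi (rev^{ε₁} i) (rev^{ε₂} j) (rev^{ε₃} k) (rev^{ε₄} l) = 0`, written with the sign table `sgnZ` (`sgnZ s.rev = −sgnZ s`) as the
plain box sum of `sgnZ⁴ · chiZ`. -/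
theorem sgnZ_chiZ_boxSum : ∀ i j k l : Fin 4,
    ∑ k' ∈ ({k, k.rev} : Finset (Fin 4)), ∑ l' ∈ ({l, l.rev} : Finset (Fin 4)), ∑ i' ∈ ({i, i.rev} : Finset (Fin 4)),
      ∑ j' ∈ ({j, j.rev} : Finset (Fin 4)), sgnZ i' * sgnZ j' * sgnZ k' * sgnZ l' * chiZ i' j' k' l' = 0 := by
  decide

/-- [folklore] The sign box sums vanish (`sgnZ s.rev = −sgnZ s` in one slot already). -/
theorem sgnZ_boxSum : ∀ i j k l : Fin 4,
    ∑ k' ∈ ({k, k.rev} : Finset (Fin 4)), ∑ l' ∈ ({l, l.rev} : Finset (Fin 4)), ∑ i' ∈ ({i, i.rev} : Finset (Fin 4)),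
      ∑ j' ∈ ({j, j.rev} : Finset (Fin 4)), sgnZ i' * sgnZ j' * sgnZ k' * sgnZ l' = 0 := by
  decide

/-- NOT IN PRINT; OUR BOOKKEEPING.  **THE SYMMETRISED TRACED WILSON TABLE `wsym22 N` HAS VANISHING BOX SUMS** (every `N`): `wsym22 N = s⁴ · ((N² − 1) − N²·chi)`, and
both `Σ_box s⁴` and `Σ_box s⁴·chi` vanish (§4's two decided identities, cast to `ℝ`).  So the degenerate cells of an3's `wilsonW₂ d (wsym22 N)` cancel ENTRYWISE. -/
theorem boxSums_wsym22 (N : ℕ) (i j k l : Fin 4) :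
    ∑ k' ∈ ({k, k.rev} : Finset (Fin 4)), ∑ l' ∈ ({l, l.rev} : Finset (Fin 4)), ∑ i' ∈ ({i, i.rev} : Finset (Fin 4)),
      ∑ j' ∈ ({j, j.rev} : Finset (Fin 4)), wsym22 N i' j' k' l' = 0 := by
  have e : ∀ i' j' k' l' : Fin 4, wsym22 N i' j' k' l'
      = ((N : ℝ) ^ 2 - 1) * ((sgnZ i' * sgnZ j' * sgnZ k' * sgnZ l' : ℤ) : ℝ)
        - (N : ℝ) ^ 2 * ((sgnZ i' * sgnZ j' * sgnZ k' * sgnZ l' * chiZ i' j' k' l' : ℤ) : ℝ) := by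
    intro i' j' k' l'
    rw [wsym22, sgn_eq_cast, sgn_eq_cast, sgn_eq_cast, sgn_eq_cast, chi_eq_cast]
    push_cast
    ring
  have hA : (∑ k' ∈ ({k, k.rev} : Finset (Fin 4)), ∑ l' ∈ ({l, l.rev} : Finset (Fin 4)), ∑ i' ∈ ({i, i.rev} : Finset (Fin 4)),
      ∑ j' ∈ ({j, j.rev} : Finset (Fin 4)), ((sgnZ i' * sgnZ j' * sgnZ k' * sgnZ l' : ℤ) : ℝ)) = 0 := by
    exact_mod_cast sgnZ_boxSum i j k l
  have hB : (∑ k' ∈ ({k, k.rev} : Finset (Fin 4)), ∑ l' ∈ ({l, l.rev} : Finset (Fin 4)), ∑ i' ∈ ({i, i.rev} : Finset (Fin 4)),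
      ∑ j' ∈ ({j, j.rev} : Finset (Fin 4)), ((sgnZ i' * sgnZ j' * sgnZ k' * sgnZ l' * chiZ i' j' k' l' : ℤ) : ℝ)) = 0 := by
    exact_mod_cast sgnZ_chiZ_boxSum i j k l
  simp_rw [e, Finset.sum_sub_distrib, ← Finset.mul_sum, hA, hB]
  ring

/-! ## §5 The four-face identity for the Wilson bi-stencil on every pattern -/

/-- NOT IN PRINT; OUR BOOKKEEPING.  **`N⁴ · fourFace_N (wilsonW₂ d T)(κ,κ′;α,β) = N^{4 − #{κ,κ′,α,β}} · zmode N (wilsonW₂ d T) κ κ′ (inl α) (inl β)`** for every `1 ≤ N`, EVERY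
direction pattern, and every position table `T` with vanishing box sums: `wilsonW₂ d T` is `LocStencil₂` (an3's `biLoc_wilsonW₂_all` at rate `1`) and unit-covariant
(`wilsonW₂_translate`), and corner-supported by §3.  Two-direction patterns: `N²` (leaf-04's «contact ratio `L²`»); the three named ones are `FourFaceOneCovCoincident` ∕
`FourFaceOneCovPlaquette`'s `(κκ;aa) ∕ (κa;κa) ∕ (κa;aκ)`. -/
theorem fourFace_wilsonW₂_mul_eq_pow_mul_zmode {N : ℕ} (hN : 1 ≤ N) (T : Fin 4 → Fin 4 → Fin 4 → Fin 4 → ℝ)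
    (hT : ∀ i j k l : Fin 4, ∑ k' ∈ ({k, k.rev} : Finset (Fin 4)), ∑ l' ∈ ({l, l.rev} : Finset (Fin 4)), ∑ i' ∈ ({i, i.rev} : Finset (Fin 4)),
      ∑ j' ∈ ({j, j.rev} : Finset (Fin 4)), T i' j' k' l' = 0)
    (κ κ' α β : Fin (d + 1)) :
    (N : ℝ) ^ 4 * ∑ rr ∈ box (d + 1) N, ∑' u' : Site (d + 1), ∑' x : Site (d + 1), ∑' z : Site (d + 1),
        (if toSite rr κ % (N : ℤ) = (N : ℤ) - 1 ∧ u' κ' % (N : ℤ) = (N : ℤ) - 1 ∧ x α % (N : ℤ) = (N : ℤ) - 1 ∧ z β % (N : ℤ) = (N : ℤ) - 1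
          then wilsonW₂ d T κ (toSite rr) κ' u' x z (Sum.inl α) (Sum.inl β) else 0)
      = (N : ℝ) ^ (4 - ({κ, κ', α, β} : Finset (Fin (d + 1))).card) * zmode N (wilsonW₂ d T) κ κ' (Sum.inl α) (Sum.inl β) := by
  have hY : LocStencil₂ (wilsonW₂ d T) (wBound₂ d T * Real.exp (8 * 1)) 1 := biLoc_wilsonW₂_all T zero_le_one
  exact fourFace_mul_eq_pow_mul_zmode_of_cornerSupport hN hY one_pos (fun κ u κ' u' t => wilsonW₂_translate T κ u κ' u' t) κ κ' α β
    (Sum.inl α) (Sum.inl β) (fun u' x z h => wilsonW₂_cornerSupport T hT κ κ' u' x z α β h)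

/-- NOT IN PRINT; OUR BOOKKEEPING.  **THE D1 LITERAL's TABLE**: for `Tc = c • wsym22 N` (the literal has `c = (8N²)⁻¹`), every `1 ≤ M` and every pattern,
`M⁴ · fourFace_M (wilsonW₂ d Tc)(κ,κ′;α,β) = M^{4 − #{κ,κ′,α,β}} · zmode M (wilsonW₂ d Tc) κ κ′ (inl α) (inl β)`. -/
theorem fourFace_wilsonW₂_wsym22 {M : ℕ} (hM : 1 ≤ M) (N : ℕ) (c : ℝ) (κ κ' α β : Fin (d + 1)) :
    (M : ℝ) ^ 4 * ∑ rr ∈ box (d + 1) M, ∑' u' : Site (d + 1), ∑' x : Site (d + 1), ∑' z : Site (d + 1),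
        (if toSite rr κ % (M : ℤ) = (M : ℤ) - 1 ∧ u' κ' % (M : ℤ) = (M : ℤ) - 1 ∧ x α % (M : ℤ) = (M : ℤ) - 1 ∧ z β % (M : ℤ) = (M : ℤ) - 1
          then wilsonW₂ d (c • wsym22 N) κ (toSite rr) κ' u' x z (Sum.inl α) (Sum.inl β) else 0)
      = (M : ℝ) ^ (4 - ({κ, κ', α, β} : Finset (Fin (d + 1))).card) * zmode M (wilsonW₂ d (c • wsym22 N)) κ κ' (Sum.inl α) (Sum.inl β) :=
  fourFace_wilsonW₂_mul_eq_pow_mul_zmode hM (c • wsym22 N) (boxSums_smul (fun i j k l => boxSums_wsym22 N i j k l) c) κ κ' α β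

/-! ## §6 The instance the (C)_0 assembly reads: the normalised comb member `0` -/

section MemberZero

variable {Lc : ℕ} [NeZero Lc]

/-- [folklore] The cell charge of member `0` on field legs is `cE₂ ·` that of an3's Wilson bi-stencil (p2's `member_zero_inl_inl` under the sums). -/
theorem zmode_memberZero_eq (N : ℕ) (cE cVH cΛ cE₂ cB : ℝ) (Tc : Fin 4 → Fin 4 → Fin 4 → Fin 4 → ℝ) (ρ : Fin (d + 1) → ℤ) {vh₂S mixFF : Tab d}
    (hBff : ∀ κ u κ' u' x z (α β : Fin (d + 1)), vh₂S κ u κ' u' x z (Sum.inl α) (Sum.inl β) = 0) (μ ν α β : Fin (d + 1)) :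
    zmode N (unitS₂ (sfStep Lc 0) (smStep d Lc 0) (T2RecAt d Lc ρ cE cVH cΛ cE₂ cB Tc vh₂S mixFF 0)) μ ν (Sum.inl α) (Sum.inl β)
      = cE₂ * zmode N (wilsonW₂ d Tc) μ ν (Sum.inl α) (Sum.inl β) := by
  unfold zmode
  simp_rw [member_zero_inl_inl cE cVH cΛ cE₂ cB Tc ρ hBff, tsum_mul_left]
  rw [← Finset.mul_sum]

/-- NOT IN PRINT; OUR BOOKKEEPING.  **THE FOUR-FACE IDENTITY FOR THE NORMALISED COMB MEMBER `0`** (any root `ρ`, any pins `cE cVH cΛ cE₂ cB`, any mixed table, a border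
`vh₂S` with no field–field block, a position table `Tc` with vanishing box sums — e.g. the literal's `(8N²)⁻¹ • wsym22 N` by `boxSums_smul` ∘ `boxSums_wsym22`; every
`1 ≤ N`, EVERY direction pattern): `N⁴ · fourFace_N (T̃_0)(μ,ν;α,β) = N^{4 − #{μ,ν,α,β}} · zmode N T̃_0 μ ν (inl α) (inl β)` — §5 behind p2's `member_zero_inl_inl`.
With `N := Lc` and a two-direction pattern this is blueprint (III) «`Lc⁴·FF_Lc(T̃_0) = Lc²·Z_Lc(T̃_0)`» as a theorem. -/
theorem fourFace_memberZero_mul_eq_pow_mul_zmode {N : ℕ} (hN : 1 ≤ N) (cE cVH cΛ cE₂ cB : ℝ) (Tc : Fin 4 → Fin 4 → Fin 4 → Fin 4 → ℝ)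
    (hT : ∀ i j k l : Fin 4, ∑ k' ∈ ({k, k.rev} : Finset (Fin 4)), ∑ l' ∈ ({l, l.rev} : Finset (Fin 4)), ∑ i' ∈ ({i, i.rev} : Finset (Fin 4)),
      ∑ j' ∈ ({j, j.rev} : Finset (Fin 4)), Tc i' j' k' l' = 0)
    (ρ : Fin (d + 1) → ℤ) {vh₂S mixFF : Tab d} (hBff : ∀ κ u κ' u' x z (α β : Fin (d + 1)), vh₂S κ u κ' u' x z (Sum.inl α) (Sum.inl β) = 0)
    (μ ν α β : Fin (d + 1)) :
    (N : ℝ) ^ 4 * ∑ rr ∈ box (d + 1) N, ∑' u' : Site (d + 1), ∑' x : Site (d + 1), ∑' z : Site (d + 1),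
        (if toSite rr μ % (N : ℤ) = (N : ℤ) - 1 ∧ u' ν % (N : ℤ) = (N : ℤ) - 1 ∧ x α % (N : ℤ) = (N : ℤ) - 1 ∧ z β % (N : ℤ) = (N : ℤ) - 1
          then unitS₂ (sfStep Lc 0) (smStep d Lc 0) (T2RecAt d Lc ρ cE cVH cΛ cE₂ cB Tc vh₂S mixFF 0) μ (toSite rr) ν u' x z (Sum.inl α) (Sum.inl β) else 0)
      = (N : ℝ) ^ (4 - ({μ, ν, α, β} : Finset (Fin (d + 1))).card) *
          zmode N (unitS₂ (sfStep Lc 0) (smStep d Lc 0) (T2RecAt d Lc ρ cE cVH cΛ cE₂ cB Tc vh₂S mixFF 0)) μ ν (Sum.inl α) (Sum.inl β) := by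
  have e : ∀ (rr : Fin (d + 1) → ℕ) (u' x z : Site (d + 1)),
      (if toSite rr μ % (N : ℤ) = (N : ℤ) - 1 ∧ u' ν % (N : ℤ) = (N : ℤ) - 1 ∧ x α % (N : ℤ) = (N : ℤ) - 1 ∧ z β % (N : ℤ) = (N : ℤ) - 1
          then unitS₂ (sfStep Lc 0) (smStep d Lc 0) (T2RecAt d Lc ρ cE cVH cΛ cE₂ cB Tc vh₂S mixFF 0) μ (toSite rr) ν u' x z (Sum.inl α) (Sum.inl β) else 0)
        = cE₂ * (if toSite rr μ % (N : ℤ) = (N : ℤ) - 1 ∧ u' ν % (N : ℤ) = (N : ℤ) - 1 ∧ x α % (N : ℤ) = (N : ℤ) - 1 ∧ z β % (N : ℤ) = (N : ℤ) - 1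
          then wilsonW₂ d Tc μ (toSite rr) ν u' x z (Sum.inl α) (Sum.inl β) else 0) := by
    intro rr u' x z
    rw [member_zero_inl_inl cE cVH cΛ cE₂ cB Tc ρ hBff]
    split_ifs
    · rfl
    · rw [mul_zero]
  simp_rw [e, tsum_mul_left]
  rw [← Finset.mul_sum, zmode_memberZero_eq N cE cVH cΛ cE₂ cB Tc ρ hBff, mul_left_comm,
    fourFace_wilsonW₂_mul_eq_pow_mul_zmode hN Tc hT μ ν α β, mul_left_comm]

/-- NOT IN PRINT; OUR BOOKKEEPING.  **THE D1 LITERAL's MEMBER `0`** (`Tc = c • wsym22 M`; the literal has `c = (8M²)⁻¹`, `hTc` of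
`ThreeFaceRecClosed.exists_allScalesSeq_JsRowD1Pin_of_C_QD`): the four-face identity of member `0` with NO table hypothesis left — every `1 ≤ N`, every pattern. -/
theorem fourFace_memberZero_wsym22 {N : ℕ} (hN : 1 ≤ N) (cE cVH cΛ cE₂ cB c : ℝ) (M : ℕ) (ρ : Fin (d + 1) → ℤ) {vh₂S mixFF : Tab d}
    (hBff : ∀ κ u κ' u' x z (α β : Fin (d + 1)), vh₂S κ u κ' u' x z (Sum.inl α) (Sum.inl β) = 0) (μ ν α β : Fin (d + 1)) :
    (N : ℝ) ^ 4 * ∑ rr ∈ box (d + 1) N, ∑' u' : Site (d + 1), ∑' x : Site (d + 1), ∑' z : Site (d + 1),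
        (if toSite rr μ % (N : ℤ) = (N : ℤ) - 1 ∧ u' ν % (N : ℤ) = (N : ℤ) - 1 ∧ x α % (N : ℤ) = (N : ℤ) - 1 ∧ z β % (N : ℤ) = (N : ℤ) - 1
          then unitS₂ (sfStep Lc 0) (smStep d Lc 0) (T2RecAt d Lc ρ cE cVH cΛ cE₂ cB (c • wsym22 M) vh₂S mixFF 0) μ (toSite rr) ν u' x z (Sum.inl α) (Sum.inl β)
          else 0)
      = (N : ℝ) ^ (4 - ({μ, ν, α, β} : Finset (Fin (d + 1))).card) *
          zmode N (unitS₂ (sfStep Lc 0) (smStep d Lc 0) (T2RecAt d Lc ρ cE cVH cΛ cE₂ cB (c • wsym22 M) vh₂S mixFF 0)) μ ν (Sum.inl α) (Sum.inl β) :=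
  fourFace_memberZero_mul_eq_pow_mul_zmode hN cE cVH cΛ cE₂ cB (c • wsym22 M) (boxSums_smul (fun i j k l => boxSums_wsym22 M i j k l) c) ρ hBff μ ν α β

end MemberZero

end Summit.QuantumFields.BalabanUV.Beta.GAN24.WilsonBiStencilCornerSupport

end
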